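import Summits.ValiantsHypothesis.ValiantsHypothesis.Theorems.LacunarySymmetroidMatrixDescartesWLawBlockSum

/-!
# `MatrixDescartes` (stmt-ValiantsHypothesis-18050) — W-LAW ROWS AT ALL SIZES, kit: the scalar model of the
# ARROWHEAD CONSTRUCTION («4 roots per flattened block»)

HONEST FRAMING.  Cell `pub-symmetroid`, seat `val-sym-mdr-p2` (gen 8); helper file `--supports` the crux
`Theses.LacunarySymmetroid.MatrixDescartes` (OPEN), NO closure claim.  This file is pure one-variable real analysis:
the SCALAR MODEL of the arrowhead W-configurations of the companion file `…WLawArrow` and the «soft» induction that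
gives it `4k + 2` sign alternations with `k` blocks.  Nothing here bears on `MatrixDescartes` in its window, on
`stub_twoSided`, `DoorA26` / `DoorA34`, the census registers, or `VP ≠ VNP`.

THE MODEL.  With the reference block shape `φ(y) = 5y²(1 − 5y + 5y² − y³) / (5 + 25y² + 5y³ + y⁵)` (`φ(y) → 0` as
`y → 0`, `φ(y) → −5` as `y → ∞`, signs `+, −, +, −` at `y = 1/10, 1/2, 2, 10`), scales `Ξᵢ > 0` and amplitudes
`Uᵢ > 0`, the model is `M(x) = x⁻³ − 1 + ∑ᵢ Uᵢ φ(x / Ξᵢ)`.  In the companion file, `x³ · ∏ᵢ mᵢ(x) · (M(x) + s x²)`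
is the determinant of an explicit `(k+1) × (k+1)` W-configuration (arrowhead letters) at `x > 0`.

THE INDUCTION (`WLawArrow.model_alternates`).  For every `k` there are `Ξ, U : Fin k → ℝ` (positive) and a strictly
DECREASING list of `4k + 2` positive points along which `M` has the signs `−, +, −, +, …, +` (from the largest point
down).  Step: given the data for `k`, put `U' := 400·(1 + 5 ∑ Uᵢ)` and let the new scale `Ξ' → ∞`: at the old points
the new term `U' φ(x/Ξ') → 0`, so their signs persist; at the new points `10Ξ', 2Ξ', Ξ'/2, Ξ'/10` the old model
tends to its limit `ℓ = −1 − 5∑Uᵢ < 0` and the new term equals `U' φ(10) < 0`, `U' φ(2) > |ℓ|`, `U' φ(1/2) < 0`,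
`U' φ(1/10) > |ℓ|` — four more alternating signs.  Finitely many eventual inequalities hold simultaneously for some
`Ξ'` (`Filter.eventually_all`, `atTop` is non-trivial).  No quantitative estimate is needed anywhere.

[folklore] Elementary real analysis over Mathlib (limits of rational functions, `Filter.Tendsto.eventually_const_lt`).
Axioms `propext`, `Classical.choice`, `Quot.sound`.
-/

set_option linter.dupNamespace false

namespace Summit.ValiantsHypothesis.ValiantsHypothesis.Theorems.LacunarySymmetroidMatrixDescartes

open scoped BigOperators Topology
open Filter Matrix

namespace WLawArrow

/-- The reference block shape `φ(y) = 5y²(1 − 5y + 5y² − y³) / (5 + 25y² + 5y³ + y⁵)` (local notation, no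
definition). -/
local notation3 (prettyPrint := false) "φ[" y "]" =>
  (5 * (y : ℝ) ^ 2 * (1 - 5 * (y : ℝ) + 5 * (y : ℝ) ^ 2 - (y : ℝ) ^ 3))
    / (5 + 25 * (y : ℝ) ^ 2 + 5 * (y : ℝ) ^ 3 + (y : ℝ) ^ 5)

/-- The scalar model `M(x) = x⁻³ − 1 + ∑ᵢ Uᵢ φ(x / Ξᵢ)` of the arrowhead construction with scales `Ξ` and
amplitudes `U` (local notation, no definition). -/
local notation3 (prettyPrint := false) "M[" Ξ ", " U "](" x ")" =>
  ((x : ℝ)⁻¹ ^ 3 - 1 + ∑ i, (U : Fin _ → ℝ) i * φ[(x : ℝ) / (Ξ : Fin _ → ℝ) i])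

/-! ## The reference block shape -/

/-- The denominator of `φ` is positive on `[0, ∞)`. [folklore] -/
theorem den_pos {y : ℝ} (hy : 0 ≤ y) : 0 < 5 + 25 * y ^ 2 + 5 * y ^ 3 + y ^ 5 := by positivity

/-- `400·φ(1/10) > 2` (first positive lobe). [folklore] -/
theorem phi_tenth : (2 : ℝ) < 400 * φ[(1 / 10 : ℝ)] := by norm_num

/-- `φ(1/2) < 0` (the valley). [folklore] -/
theorem phi_half : φ[(1 / 2 : ℝ)] < 0 := by norm_num

/-- `400·φ(2) > 2` (second positive lobe). [folklore] -/
theorem phi_two : (2 : ℝ) < 400 * φ[(2 : ℝ)] := by norm_num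

/-- `φ(10) < 0` (the negative tail). [folklore] -/
theorem phi_ten : φ[(10 : ℝ)] < 0 := by norm_num

/-- `φ(y) → 0` as `y → 0`. [folklore] -/
theorem tendsto_phi_zero : Tendsto (fun y : ℝ => φ[y]) (𝓝 0) (𝓝 0) := by
  have h : ContinuousAt (fun y : ℝ => φ[y]) 0 := by
    refine ContinuousAt.div ?_ ?_ ?_
    · fun_prop
    · fun_prop
    · norm_num
  simpa using h.tendsto

/-- `φ(y) → −5` as `y → ∞`. [folklore] -/
theorem tendsto_phi_atTop : Tendsto (fun y : ℝ => φ[y]) atTop (𝓝 (-5)) := by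
  have hg : Tendsto (fun u : ℝ => (5 * u ^ 3 - 25 * u ^ 2 + 25 * u - 5)
      / (5 * u ^ 5 + 25 * u ^ 3 + 5 * u ^ 2 + 1)) (𝓝 0) (𝓝 (-5)) := by
    have hc : ContinuousAt (fun u : ℝ => (5 * u ^ 3 - 25 * u ^ 2 + 25 * u - 5)
        / (5 * u ^ 5 + 25 * u ^ 3 + 5 * u ^ 2 + 1)) 0 := by
      refine ContinuousAt.div ?_ ?_ ?_
      · fun_prop
      · fun_prop
      · norm_num
    simpa using hc.tendsto
  refine (hg.comp tendsto_inv_atTop_zero).congr' ?_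
  filter_upwards [eventually_gt_atTop (0 : ℝ)] with y hy
  have hy' : y ≠ 0 := hy.ne'
  have hd : (5 + 25 * y ^ 2 + 5 * y ^ 3 + y ^ 5) ≠ 0 := (den_pos hy.le).ne'
  simp only [Function.comp_apply]
  rw [div_eq_div_iff ?_ hd]
  · field_simp
    ring
  · have : 0 < 5 * y⁻¹ ^ 5 + 25 * y⁻¹ ^ 3 + 5 * y⁻¹ ^ 2 + 1 := by positivity
    exact this.ne'

/-! ## The scalar model: limits -/

/-- Adding a block: the model with `snoc`-extended data is the old model plus `U' φ(x/Ξ')`. [bookkeeping] -/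
theorem model_snoc {k : ℕ} (Ξ U : Fin k → ℝ) (Ξ' U' x : ℝ) :
    M[Fin.snoc Ξ Ξ', Fin.snoc U U'](x) = M[Ξ, U](x) + U' * φ[x / Ξ'] := by
  simp only [Fin.sum_univ_castSucc, Fin.snoc_castSucc, Fin.snoc_last]
  ring

/-- As `x → ∞` the model tends to `−1 − 5 ∑ Uᵢ`. [folklore] -/
theorem model_tendsto_atTop {k : ℕ} (Ξ U : Fin k → ℝ) (hΞ : ∀ i, 0 < Ξ i) :
    Tendsto (fun x : ℝ => M[Ξ, U](x)) atTop (𝓝 (-1 - 5 * ∑ i, U i)) := by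
  have h1 : Tendsto (fun x : ℝ => x⁻¹ ^ 3) atTop (𝓝 0) := by
    simpa using (tendsto_inv_atTop_zero (𝕜 := ℝ)).pow 3
  have h2 : ∀ i, Tendsto (fun x : ℝ => U i * φ[x / Ξ i]) atTop (𝓝 (U i * (-5))) := fun i =>
    (tendsto_phi_atTop.comp (tendsto_id.atTop_div_const (hΞ i))).const_mul (U i)
  have h3 : Tendsto (fun x : ℝ => ∑ i, U i * φ[x / Ξ i]) atTop (𝓝 (∑ i, U i * (-5))) :=
    tendsto_finsetSum _ fun i _ => h2 i
  have := (h1.sub_const 1).add h3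
  convert this using 2
  simp only [mul_neg, Finset.sum_neg_distrib, Finset.mul_sum]
  ring

/-- At a fixed point `x`, the contribution of a new block of scale `Ξ' → ∞` vanishes. [folklore] -/
theorem tendsto_newBlock_zero (x U' : ℝ) :
    Tendsto (fun Ξ' : ℝ => U' * φ[x / Ξ']) atTop (𝓝 0) := by
  have h : Tendsto (fun Ξ' : ℝ => x / Ξ') atTop (𝓝 0) := tendsto_id.const_div_atTop x
  simpa using (tendsto_phi_zero.comp h).const_mul U'

/-- At a new point `y·Ξ'` (`y > 0` fixed, `Ξ' → ∞`) the old model tends to its limit at `∞`. [folklore] -/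
theorem tendsto_model_newPoint {k : ℕ} (Ξ U : Fin k → ℝ) (hΞ : ∀ i, 0 < Ξ i) {y : ℝ} (hy : 0 < y) :
    Tendsto (fun Ξ' : ℝ => M[Ξ, U](y * Ξ')) atTop (𝓝 (-1 - 5 * ∑ i, U i)) :=
  (model_tendsto_atTop Ξ U hΞ).comp (tendsto_id.const_mul_atTop hy)

/-! ## Sign bookkeeping along `vecCons` -/

/-- Prepending four points with signs `−, +, −, +` to an alternating list keeps it alternating (the parity of
the old indices is unchanged). [bookkeeping] -/
theorem alt_cons₄ {m : ℕ} (f : ℝ → ℝ) (σ : Fin (m + 1) → ℝ) {a b c d : ℝ}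
    (ha : f a < 0) (hb : 0 < f b) (hc : f c < 0) (hd : 0 < f d)
    (hσ : ∀ j : Fin (m + 1), 0 < (-1 : ℝ) ^ ((j : ℕ) + 1) * f (σ j)) :
    ∀ j : Fin (m + 1 + 1 + 1 + 1 + 1),
      0 < (-1 : ℝ) ^ ((j : ℕ) + 1) * f (vecCons a (vecCons b (vecCons c (vecCons d σ))) j) := by
  intro j
  refine Fin.cases ?_ (fun j => ?_) j
  · simp only [Fin.val_zero, Matrix.cons_val_zero]
    norm_num
    exact ha
  refine Fin.cases ?_ (fun j => ?_) j
  · simp only [Fin.val_succ, Fin.val_zero, Matrix.cons_val_succ, Matrix.cons_val_zero]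
    norm_num
    exact hb
  refine Fin.cases ?_ (fun j => ?_) j
  · simp only [Fin.val_succ, Fin.val_zero, Matrix.cons_val_succ, Matrix.cons_val_zero]
    norm_num
    exact hc
  refine Fin.cases ?_ (fun j => ?_) j
  · simp only [Fin.val_succ, Fin.val_zero, Matrix.cons_val_succ, Matrix.cons_val_zero]
    norm_num
    exact hd
  have h := hσ j
  have h4 : (-1 : ℝ) ^ ((j : ℕ) + 1 + 1 + 1 + 1 + 1) = (-1 : ℝ) ^ ((j : ℕ) + 1) := by ring
  simp only [Fin.val_succ, Matrix.cons_val_succ]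
  rw [h4]
  exact h

/-- All entries positive after prepending four positive points. [bookkeeping] -/
theorem pos_cons₄ {m : ℕ} (σ : Fin (m + 1) → ℝ) {a b c d : ℝ}
    (ha : 0 < a) (hb : 0 < b) (hc : 0 < c) (hd : 0 < d) (hσ : ∀ j, 0 < σ j) :
    ∀ j : Fin (m + 1 + 1 + 1 + 1 + 1), 0 < (vecCons a (vecCons b (vecCons c (vecCons d σ))) j) := by
  intro j
  refine Fin.cases ?_ (fun j => ?_) j
  · simpa using ha
  refine Fin.cases ?_ (fun j => ?_) j
  · simpa using hb
  refine Fin.cases ?_ (fun j => ?_) j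
  · simpa using hc
  refine Fin.cases ?_ (fun j => ?_) j
  · simpa using hd
  simpa [Matrix.cons_val_succ] using hσ j

/-! ## The induction step -/

set_option maxHeartbeats 400000 in
/-- **One more block.**  Given scales / amplitudes `Ξ, U : Fin k → ℝ` (positive) and a strictly decreasing list
`σ` of positive points along which the model alternates `−, +, −, …` (from the largest point), there are `Ξ', U' > 0`
such that the extended model (block `k+1` of scale `Ξ'`, amplitude `U'`) alternates along the list extended by the
four points `10Ξ' > 2Ξ' > Ξ'/2 > Ξ'/10` on top. [folklore] -/
theorem step {k m : ℕ} (Ξ U : Fin k → ℝ) (hΞ : ∀ i, 0 < Ξ i) (hU : ∀ i, 0 < U i)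
    (σ : Fin (m + 1) → ℝ) (hanti : StrictAnti σ) (hpos : ∀ j, 0 < σ j)
    (hsign : ∀ j : Fin (m + 1), 0 < (-1 : ℝ) ^ ((j : ℕ) + 1) * M[Ξ, U](σ j)) :
    ∃ Ξ' U' : ℝ, 0 < Ξ' ∧ 0 < U' ∧
      StrictAnti (vecCons (10 * Ξ') (vecCons (2 * Ξ') (vecCons (Ξ' / 2) (vecCons (Ξ' / 10) σ)))) ∧
      (∀ j, 0 < (vecCons (10 * Ξ') (vecCons (2 * Ξ') (vecCons (Ξ' / 2) (vecCons (Ξ' / 10) σ)))) j) ∧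
      ∀ j : Fin (m + 1 + 1 + 1 + 1 + 1), 0 < (-1 : ℝ) ^ ((j : ℕ) + 1) *
        M[Fin.snoc Ξ Ξ', Fin.snoc U U'](
          (vecCons (10 * Ξ') (vecCons (2 * Ξ') (vecCons (Ξ' / 2) (vecCons (Ξ' / 10) σ)))) j) := by
  -- the limit of the old model at `∞` and the new amplitude
  set L : ℝ := ∑ i, U i with hL
  have hL0 : 0 ≤ L := Finset.sum_nonneg fun i _ => (hU i).le
  set U' : ℝ := 400 * (1 + 5 * L) with hU'
  have hU'pos : 0 < U' := by rw [hU']; positivity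
  -- (E1) old points keep their signs
  have E1 : ∀ j : Fin (m + 1), ∀ᶠ Ξ' : ℝ in atTop,
      0 < (-1 : ℝ) ^ ((j : ℕ) + 1) * (M[Ξ, U](σ j) + U' * φ[σ j / Ξ']) := by
    intro j
    have ht : Tendsto (fun Ξ' : ℝ => (-1 : ℝ) ^ ((j : ℕ) + 1) * (M[Ξ, U](σ j) + U' * φ[σ j / Ξ']))
        atTop (𝓝 ((-1 : ℝ) ^ ((j : ℕ) + 1) * (M[Ξ, U](σ j) + 0))) :=
      ((tendsto_newBlock_zero (σ j) U').const_add _).const_mul _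
    rw [add_zero] at ht
    exact ht.eventually_const_lt (hsign j)
  -- (E2) the four new points
  have E2 : ∀ y : ℝ, 0 < y → ∀ c : ℝ, c < -1 - 5 * L + U' * φ[y] →
      ∀ᶠ Ξ' : ℝ in atTop, c < M[Ξ, U](y * Ξ') + U' * φ[y * Ξ' / Ξ'] := by
    intro y hy c hc
    have ht : Tendsto (fun Ξ' : ℝ => M[Ξ, U](y * Ξ') + U' * φ[y * Ξ' / Ξ']) atTop
        (𝓝 (-1 - 5 * L + U' * φ[y])) := by
      refine ((tendsto_model_newPoint Ξ U hΞ hy).add_const (U' * φ[y])).congr' ?_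
      filter_upwards [eventually_gt_atTop (0 : ℝ)] with Ξ' hΞ'
      rw [mul_div_cancel_right₀ y hΞ'.ne']
    exact ht.eventually_const_lt hc
  have E2' : ∀ y : ℝ, 0 < y → ∀ c : ℝ, -1 - 5 * L + U' * φ[y] < c →
      ∀ᶠ Ξ' : ℝ in atTop, M[Ξ, U](y * Ξ') + U' * φ[y * Ξ' / Ξ'] < c := by
    intro y hy c hc
    have ht : Tendsto (fun Ξ' : ℝ => M[Ξ, U](y * Ξ') + U' * φ[y * Ξ' / Ξ']) atTop
        (𝓝 (-1 - 5 * L + U' * φ[y])) := by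
      refine ((tendsto_model_newPoint Ξ U hΞ hy).add_const (U' * φ[y])).congr' ?_
      filter_upwards [eventually_gt_atTop (0 : ℝ)] with Ξ' hΞ'
      rw [mul_div_cancel_right₀ y hΞ'.ne']
    exact ht.eventually_lt_const hc
  -- the signs of the four limiting values
  have s10 : -1 - 5 * L + U' * φ[(10 : ℝ)] < 0 := by
    have : U' * φ[(10 : ℝ)] < 0 := mul_neg_of_pos_of_neg hU'pos phi_ten
    linarith
  have s2 : (0 : ℝ) < -1 - 5 * L + U' * φ[(2 : ℝ)] := by
    have h := phi_two
    have : U' * φ[(2 : ℝ)] = (1 + 5 * L) * (400 * φ[(2 : ℝ)]) := by rw [hU']; ring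
    rw [this]
    nlinarith
  have shalf : -1 - 5 * L + U' * φ[(1 / 2 : ℝ)] < 0 := by
    have : U' * φ[(1 / 2 : ℝ)] < 0 := mul_neg_of_pos_of_neg hU'pos phi_half
    linarith
  have stenth : (0 : ℝ) < -1 - 5 * L + U' * φ[(1 / 10 : ℝ)] := by
    have h := phi_tenth
    have : U' * φ[(1 / 10 : ℝ)] = (1 + 5 * L) * (400 * φ[(1 / 10 : ℝ)]) := by rw [hU']; ring
    rw [this]
    nlinarith
  -- collect finitely many eventual facts and pick `Ξ'`
  obtain ⟨Ξ', hΞ'pos, hΞ'big, hold, hn10, hn2, hnhalf, hntenth⟩ :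
      ∃ Ξ' : ℝ, 0 < Ξ' ∧ 10 * σ 0 < Ξ' ∧
        (∀ j : Fin (m + 1), 0 < (-1 : ℝ) ^ ((j : ℕ) + 1) * (M[Ξ, U](σ j) + U' * φ[σ j / Ξ'])) ∧
        M[Ξ, U](10 * Ξ') + U' * φ[10 * Ξ' / Ξ'] < 0 ∧
        0 < M[Ξ, U](2 * Ξ') + U' * φ[2 * Ξ' / Ξ'] ∧
        M[Ξ, U](1 / 2 * Ξ') + U' * φ[1 / 2 * Ξ' / Ξ'] < 0 ∧
        0 < M[Ξ, U](1 / 10 * Ξ') + U' * φ[1 / 10 * Ξ' / Ξ'] := by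
    have hall : ∀ᶠ Ξ' : ℝ in atTop, 0 < Ξ' ∧ 10 * σ 0 < Ξ' ∧
        (∀ j : Fin (m + 1), 0 < (-1 : ℝ) ^ ((j : ℕ) + 1) * (M[Ξ, U](σ j) + U' * φ[σ j / Ξ'])) ∧
        M[Ξ, U](10 * Ξ') + U' * φ[10 * Ξ' / Ξ'] < 0 ∧
        0 < M[Ξ, U](2 * Ξ') + U' * φ[2 * Ξ' / Ξ'] ∧
        M[Ξ, U](1 / 2 * Ξ') + U' * φ[1 / 2 * Ξ' / Ξ'] < 0 ∧
        0 < M[Ξ, U](1 / 10 * Ξ') + U' * φ[1 / 10 * Ξ' / Ξ'] := by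
      refine (eventually_gt_atTop 0).and ((eventually_gt_atTop _).and ((eventually_all.2 E1).and
        ((E2' 10 (by norm_num) 0 s10).and ((E2 2 (by norm_num) 0 s2).and
          ((E2' (1 / 2) (by norm_num) 0 shalf).and (E2 (1 / 10) (by norm_num) 0 stenth))))))
    exact hall.exists
  refine ⟨Ξ', U', hΞ'pos, hU'pos, ?_, ?_, ?_⟩
  · -- strictly decreasing
    refine StrictAnti.vecCons (StrictAnti.vecCons (StrictAnti.vecCons (StrictAnti.vecCons hanti ?_) ?_) ?_) ?_
    · show σ 0 < Ξ' / 10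
      linarith
    · show Ξ' / 10 < Ξ' / 2
      linarith
    · show Ξ' / 2 < 2 * Ξ'
      linarith
    · show 2 * Ξ' < 10 * Ξ'
      linarith
  · exact pos_cons₄ σ (by positivity) (by positivity) (by positivity) (by positivity) hpos
  · refine alt_cons₄ (fun x => M[Fin.snoc Ξ Ξ', Fin.snoc U U'](x)) σ ?_ ?_ ?_ ?_ ?_
    · rw [model_snoc]; simpa using hn10
    · rw [model_snoc]; simpa using hn2
    · rw [model_snoc]
      have : Ξ' / 2 = 1 / 2 * Ξ' := by ring
      rw [this]; exact hnhalf
    · rw [model_snoc]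
      have : Ξ' / 10 = 1 / 10 * Ξ' := by ring
      rw [this]; exact hntenth
    · intro j
      rw [model_snoc]
      exact hold j

/-- **THE SCALAR MODEL ALTERNATES `4k + 2` TIMES.**  For every `k` there are positive scales and amplitudes
`Ξ, U : Fin k → ℝ` and a strictly decreasing list of `4k + 2` positive points along which the model
`x⁻³ − 1 + ∑ᵢ Uᵢ φ(x/Ξᵢ)` has the signs `−, +, −, +, …, +` (from the largest point down). [folklore] -/
theorem model_alternates (k : ℕ) :
    ∃ (Ξ U : Fin k → ℝ) (σ : Fin (4 * k + 1 + 1) → ℝ), (∀ i, 0 < Ξ i) ∧ (∀ i, 0 < U i) ∧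
      StrictAnti σ ∧ (∀ j, 0 < σ j) ∧
      ∀ j : Fin (4 * k + 1 + 1), 0 < (-1 : ℝ) ^ ((j : ℕ) + 1) * M[Ξ, U](σ j) := by
  induction k with
  | zero =>
    refine ⟨Fin.elim0, Fin.elim0, ![2, 1 / 2], fun i => i.elim0, fun i => i.elim0, ?_, ?_, ?_⟩
    · refine StrictAnti.vecCons (strictAnti_vecEmpty) ?_
      show (1 : ℝ) / 2 < 2
      norm_num
    · intro j
      fin_cases j <;> simp
    · intro j
      fin_cases j <;> simp <;> norm_num
  | succ k ih =>
    obtain ⟨Ξ, U, σ, hΞ, hU, hanti, hpos, hsign⟩ := ih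
    obtain ⟨Ξ', U', hΞ', hU', hanti', hpos', hsign'⟩ := step Ξ U hΞ hU σ hanti hpos hsign
    refine ⟨Fin.snoc Ξ Ξ', Fin.snoc U U',
      vecCons (10 * Ξ') (vecCons (2 * Ξ') (vecCons (Ξ' / 2) (vecCons (Ξ' / 10) σ))), ?_, ?_, hanti', hpos',
      hsign'⟩
    · intro i
      refine Fin.lastCases ?_ (fun i => ?_) i
      · simpa using hΞ'
      · simpa using hΞ i
    · intro i
      refine Fin.lastCases ?_ (fun i => ?_) i
      · simpa using hU'
      · simpa using hU i

end WLawArrow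

end Summit.ValiantsHypothesis.ValiantsHypothesis.Theorems.LacunarySymmetroidMatrixDescartes
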